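import Summits.KontsevichZagierPeriods.KontsevichZagierPeriods.Theorems.MultiplicationThree.Negative.Pinned

/-!
# `MultiplicationThree` (stmt-KontsevichZagierPeriods-3598) — negative knowledge, part 5: box-to-box form

The chart `Φ(u,v) = (3u, 3(1-u)v)` of part 1 is itself ONE rule-(2) move:
`[pullbackRep s] − [simplexRep s] ∈ KZ.changeOfVariablesRel` with
`pullbackRep s = [box, 9·(27uv(1−v))^{s−1}(1−u)^{2s−1}]`, a presented box-Mellin member
(`KZ.IsMellinMemberWith`) with RATIONAL constant `9`, family `(27·X₀X₁(1−X₁), 1−X₀)`, exponents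
`(s−1, 2s−1)`. Hence `multiplicationThree_iff_boxToBox`: the crux ⇔ for every rational `s > 0`,
`Equivalent (boxRep s hs) (pullbackRep s hs)` — a relation between two presented members of the
dimension-2 Mellin box family on the SAME box (`B(1/3,s)B(2/3,s) = 9·27^{s-1}B(s,2s)B(s,s)` as box
representations), the form in which Mellin-fibre / Beta-bookkeeping arguments apply. (cdisprove gen 1.)
-/

noncomputable section

open MeasureTheory Set Real
open scoped BigOperators

namespace Summit.KontsevichZagierPeriods.TerasomaMultiplication.MultiplicationThreeNegative

open Literature.NumberTheory.Transcendental
open Literature.NumberTheory.Transcendental.KZ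
open Literature.ModelTheory.ExponentialFields (IsSemialgebraic)
open MvPolynomial (aeval X C)
open Summit.KontsevichZagierPeriods.KontsevichZagierPeriods.Theses.TerasomaMultiplication
  (MultiplicationThree)

/-! ## §5 Box-to-box form

The chart `Φ` is itself ONE rule-(2) move: `[triangle, (σ₁σ₂(3−σ₁−σ₂))^{s−1}] ~ [box, 9·(27uv(1−v))^{s−1}(1−u)^{2s−1}]`
(`pullbackRep`), a box-Mellin member with RATIONAL constant `κ = 9`, family `(27·X₀X₁(1−X₁), 1−X₀)`
and exponents `(s−1, 2s−1)`. So the crux is EQUIVALENT to a relation between two members of the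
dimension-2 Mellin box family on the SAME box (`multiplicationThree_iff_boxToBox`):
`[box, u^{-2/3}(1-u)^{s-1}v^{-1/3}(1-v)^{s-1}] ~ [box, 9(27uv(1-v))^{s-1}(1-u)^{2s-1}]`, i.e.
`B(1/3,s)B(2/3,s) = 9·27^{s-1}B(s,2s)B(s,s)` as box representations — the form in which
MellinCoarea-type (fibre/coset) arguments and the route's Beta bookkeeping apply directly. -/

/-- The pulled-back integrand `9·(27uv(1−v))^{s−1}(1−u)^{2s−1}` on the box. [folklore] -/
def pullbackFun (s : ℚ) : (Fin 2 → ℝ) → ℝ := fun x =>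
  9 * (27 * x 0 * x 1 * (1 - x 1)) ^ ((s:ℝ) - 1) * (1 - x 0) ^ (2 * (s:ℝ) - 1)

/-- The Mellin family of the pulled-back integrand. [folklore] -/
def pullbackPolys : Fin 2 → MvPolynomial (Fin 2) ℚ := ![27 * X 0 * X 1 * (1 - X 1), 1 - X 0]

/-- The Mellin exponents of the pulled-back integrand. [folklore] -/
def pullbackExps (s : ℚ) : Fin 2 → ℚ := ![s - 1, 2 * s - 1]

/-- On the box the pulled-back integrand is the Euler–Mellin integrand of
`(pullbackPolys, pullbackExps s, 9)` — constant `κ = 9 ∈ ℚ`. [folklore] -/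
theorem pullbackFun_eq_mellinIntegrand (s : ℚ) {x : Fin 2 → ℝ} :
    pullbackFun s x = mellinIntegrand pullbackPolys (pullbackExps s) 9 x := by
  have h27 : aeval x (27 : MvPolynomial (Fin 2) ℚ) = (27 : ℝ) := by
    rw [show (27 : MvPolynomial (Fin 2) ℚ) = C 27 by simp [map_ofNat], MvPolynomial.aeval_C]; simp
  simp only [pullbackFun, mellinIntegrand, Fin.prod_univ_two, pullbackPolys, pullbackExps,
    Matrix.cons_val_zero, Matrix.cons_val_one, map_sub, map_one, map_mul, MvPolynomial.aeval_X,
    h27, Rat.cast_sub, Rat.cast_mul, Rat.cast_one, Rat.cast_ofNat]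
  ring

/-- The pulled-back integrand is `ℚ`-semialgebraic on the box. [folklore] -/
theorem isSemialgebraicFunOn_pullbackFun (s : ℚ) : IsSemialgebraicFunOn ℚ box (pullbackFun s) := by
  refine (isSemialgebraicFunOn_mellinIntegrand isSemialgebraic_box pullbackPolys (pullbackExps s) 9
    ?_).congr fun x _ => (pullbackFun_eq_mellinIntegrand s).symm
  intro x hx k
  have h0 := hx 0
  have h1 := hx 1
  have h27 : aeval x (27 : MvPolynomial (Fin 2) ℚ) = (27 : ℝ) := by
    rw [show (27 : MvPolynomial (Fin 2) ℚ) = C 27 by simp [map_ofNat], MvPolynomial.aeval_C]; simp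
  fin_cases k
  · simp only [pullbackPolys, Fin.zero_eta, Matrix.cons_val_zero, map_mul, map_sub, map_one,
      MvPolynomial.aeval_X, h27]
    exact mul_pos (mul_pos (mul_pos (by norm_num) h0.1) h1.1) (sub_pos.2 h1.2)
  · simp only [pullbackPolys, Fin.mk_one, Matrix.cons_val_one, Matrix.cons_val_zero, map_sub,
      map_one, MvPolynomial.aeval_X]
    exact sub_pos.2 h0.2

/-- On the box, the pulled-back integrand is `9·27^{s−1}·u^{s−1}(1−u)^{2s−1}·v^{s−1}(1−v)^{s−1}`. [folklore] -/
theorem pullbackFun_eq_prod {s : ℚ} {x : Fin 2 → ℝ} (hx : x ∈ box) :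
    pullbackFun s x = pullConst s * ∏ i, pullFactor s i (x i) := by
  have hu0 : 0 < x 0 := (hx 0).1
  have hv0 : 0 < x 1 := (hx 1).1
  have hv1 : 0 < 1 - x 1 := sub_pos.2 (hx 1).2
  simp only [pullbackFun, pullConst, pullFactor, Fin.prod_univ_two, Matrix.cons_val_zero,
    Matrix.cons_val_one]
  rw [Real.mul_rpow (by positivity) hv1.le, Real.mul_rpow (by positivity) hv0.le,
    Real.mul_rpow (by norm_num) hu0.le]
  ring

/-- On the box, the pulled-back integrand is `(simplexFun s ∘ Φ) · |det DΦ|`. [folklore] -/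
theorem pullbackFun_eq_jacobian {s : ℚ} {x : Fin 2 → ℝ} (hx : x ∈ box) :
    pullbackFun s x = simplexFun s (Φ x) * |(Φ' x).det| := by
  rw [pullbackFun_eq_prod hx, ← pullback_eq hx, mul_comm]

/-- The pulled-back integrand is integrable on the box. [folklore] -/
theorem integrableOn_pullbackFun {s : ℚ} (hs : 0 < s) : IntegrableOn (pullbackFun s) box :=
  (integrableOn_pullback hs).congr_fun (fun _ hx => (pullbackFun_eq_prod hx).symm) measurableSet_box

/-- **The pulled-back box representation** `[box, 9·(27uv(1−v))^{s−1}(1−u)^{2s−1}]`. [folklore] -/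
def pullbackRep (s : ℚ) (hs : 0 < s) : IntegralRep 2 where
  domain := box
  integrand := pullbackFun s
  isSemialgebraic_domain := isSemialgebraic_box
  isSemialgebraicFunOn_integrand := isSemialgebraicFunOn_pullbackFun s
  integrableOn := integrableOn_pullbackFun hs

/-- The substitution polynomials of the chart `Φ`. [folklore] -/
def chartSubst : Fin 2 → MvPolynomial (Fin 2) ℚ := ![3 * X 0, 3 * (1 - X 0) * X 1]

/-- Evaluating the substitution is the chart. [folklore] -/
theorem aeval_chartSubst (x : Fin 2 → ℝ) : (fun i => aeval x (chartSubst i)) = Φ x := by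
  have h3 : aeval x (3 : MvPolynomial (Fin 2) ℚ) = (3 : ℝ) := by
    rw [show (3 : MvPolynomial (Fin 2) ℚ) = C 3 by simp [map_ofNat], MvPolynomial.aeval_C]; simp
  funext i
  fin_cases i
  · simp [chartSubst, h3]
  · simp [chartSubst, h3]

/-- The chart is a `ℚ`-semialgebraic map on the box (a polynomial map). [folklore] -/
theorem isSemialgebraicMapOn_Φ : IsSemialgebraicMapOn ℚ box Φ := by
  convert isSemialgebraicMapOn_aeval isSemialgebraic_box chartSubst using 2 with z
  exact (aeval_chartSubst z).symm

/-- **The chart is ONE rule-(2) move**: `[pullbackRep] − [simplexRep] ∈ changeOfVariablesRel`. [cite: KontsevichZagier2001, §1.2 rule (2)] -/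
theorem pullbackRep_sub_simplexRep_mem_changeOfVariablesRel {s : ℚ} (hs : 0 < s) :
    of (pullbackRep s hs) - of (simplexRep s hs) ∈ changeOfVariablesRel :=
  ⟨2, pullbackRep s hs, simplexRep s hs, Φ, Φ', isSemialgebraicMapOn_Φ,
    fun x _ => (hasFDerivAt_Φ x).hasFDerivWithinAt, injOn_Φ, image_Φ_box.symm,
    fun _ hx => pullbackFun_eq_jacobian hx, rfl⟩

/-- The pulled-back box representation is equivalent to the simplex representation. [folklore] -/
theorem pullbackRep_equivalent_simplexRep {s : ℚ} (hs : 0 < s) :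
    Equivalent (pullbackRep s hs) (simplexRep s hs) :=
  changeOfVariablesRel_subset_relations (pullbackRep_sub_simplexRep_mem_changeOfVariablesRel hs)

/-- **Box-to-box form of the crux**: `MultiplicationThree` ⇔ for every rational `s > 0`,
`[box, u^{-2/3}(1-u)^{s-1}v^{-1/3}(1-v)^{s-1}] ~ [box, 9·(27uv(1−v))^{s−1}(1−u)^{2s−1}]` — two
box-Mellin members of dimension 2 on the same box (`B(1/3,s)B(2/3,s) = 9·27^{s-1}B(s,2s)B(s,s)`).
[folklore] -/
theorem multiplicationThree_iff_boxToBox :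
    MultiplicationThree ↔ ∀ (s : ℚ) (hs : 0 < s), Equivalent (boxRep s hs) (pullbackRep s hs) := by
  rw [multiplicationThree_iff_pinned]
  refine forall_congr' fun s => forall_congr' fun hs => ?_
  exact ⟨fun h => h.trans (pullbackRep_equivalent_simplexRep hs).symm,
    fun h => h.trans (pullbackRep_equivalent_simplexRep hs)⟩

/-- The pulled-back representation is a presented box-Mellin member with rational constant `9`
(vocabulary of `KZMellinFibres`; its Mellin box is the whole box). [folklore] -/
theorem isMellinMemberWith_pullbackRep {s : ℚ} (hs : 0 < s) :
    IsMellinMemberWith pullbackPolys (pullbackExps s) 9 (pullbackRep s hs) := by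
  refine ⟨?_, fun x _ => pullbackFun_eq_mellinIntegrand s⟩
  ext x
  simp only [mem_mellinBox]
  constructor
  · intro hx
    refine ⟨hx, fun k => ?_⟩
    have h0 := hx 0
    have h1 := hx 1
    have h27 : aeval x (27 : MvPolynomial (Fin 2) ℚ) = (27 : ℝ) := by
      rw [show (27 : MvPolynomial (Fin 2) ℚ) = C 27 by simp [map_ofNat], MvPolynomial.aeval_C]; simp
    fin_cases k
    · simp only [pullbackPolys, Fin.zero_eta, Matrix.cons_val_zero, map_mul, map_sub, map_one,
        MvPolynomial.aeval_X, h27]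
      exact mul_pos (mul_pos (mul_pos (by norm_num) h0.1) h1.1) (sub_pos.2 h1.2)
    · simp only [pullbackPolys, Fin.mk_one, Matrix.cons_val_one, Matrix.cons_val_zero, map_sub,
        map_one, MvPolynomial.aeval_X]
      exact sub_pos.2 h0.2
  · exact fun h => h.1

/-- The box representation is a presented box-Mellin member with constant `1`. [folklore] -/
theorem isMellinMemberWith_boxRep {s : ℚ} (hs : 0 < s) :
    IsMellinMemberWith boxPolys (boxExps s) 1 (boxRep s hs) := by
  refine ⟨?_, fun x _ => boxFun_eq_mellinIntegrand s⟩
  ext x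
  simp only [mem_mellinBox]
  constructor
  · intro hx
    refine ⟨hx, fun k => ?_⟩
    have h0 := hx 0
    have h1 := hx 1
    fin_cases k <;> simp [boxPolys, h0.1, h1.1, h0.2, h1.2]
  · exact fun h => h.1

end Summit.KontsevichZagierPeriods.TerasomaMultiplication.MultiplicationThreeNegative
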